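import Literature.NumberTheory.Transcendental.RoySmallValueGainVeronese
import Literature.NumberTheory.Transcendental.RoySmallValueDescentK
import Literature.NumberTheory.Transcendental.RoySmallValueVeronese
import HarnessLib

/-!
# Roy's small value estimate for `𝔾ₐ × 𝔾ₘ` — the height gain for `F = Φ(P, Q, ·)`

Topic `Literature/NumberTheory/Transcendental`. Part of the formalisation of the proof of Roy 2013,
Theorem 1.1 (named fact `roy2013_thm_1_1`, `RoySmallValueEstimates.lean`). Source: D. Roy,
*A small value estimate for `𝔾ₐ × 𝔾ₘ`*, Mathematika 59 (2013) 333–363 = arXiv:1301.0663, §2,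
Proposition 2.3 and §6, Proposition 6.2 (pp. 7, 16 of the arXiv text):

> `|log|a| − D h(Z)| ≤ 7 log(m+1) D deg(Z)` [...]
> **Proposition 6.2.** [...] `h_𝒞(Z) ≤ −C''(Y deg(Z) + D h(Z))`.

For integer forms `P, Q`, the normalised representatives `α_j` of `𝒵(P, Q)` with their number field
`K` (`ZeroConfigK`), and the complex factorisation `F₀ = c ∏_j ℓ_{α_j}^{e_j}` of
`F₀ = Φ(P, Q, ·) ∈ ℤ[r]` with exact multiplicities, we prove the HEIGHT GAIN

  `D ∑_j e_j h_K(a_j) ≤ [K:ℚ] ( log|c| + D ∑_j e_j log ‖α_j‖_∞ )`     (`gain`)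

i.e. `log|c_sup| ≥ (D/[K:ℚ]) ∑_j e_j h_K(a_j)` for the leading constant `c_sup = c ∏ ‖α_j‖^{D e_j}`
of `F₀` written with sup-normalised linear forms — Roy's `log|a| ≥ D h(Z) − O(D deg Z)`, exact. It
combines the general lower bound `sum_mul_logHeight_le_sum_embeddings` (`RoySmallValueGain`,
transported to an arbitrary finite variable type in the tree's `RoySmallValueGainVeronese`), the descent of the factorisation to `K` and
`σ(A) = c` (`RoySmallValueDescentK`), the invariance `e_{g·j} = e_j`, and the Veronese height
identity `h_K((a^ν)_ν) = D h_K(a)` (`RoySmallValueVeronese`). Everything is proved; no definitions,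
no named facts.

## References

* [Roy2013] D. Roy, *A small value estimate for 𝔾ₐ × 𝔾ₘ*, Mathematika 59 (2013), 333–363
  (arXiv:1301.0663), Proposition 2.3 and Proposition 6.2.
-/

noncomputable section

open MvPolynomial NumberField Height Finset

namespace Literature.NumberTheory.Transcendental

namespace Roy2013

-- The transport `sum_mul_logHeight_le_sum_embeddings'` of the lower bound to arbitrary finite
-- variable types is the tree's (`RoySmallValueGainVeronese`, seat B).

/-! ### The sup of the monomial values -/

/-- The sup norm of a point of `ℂ³` is attained. [folklore] -/
theorem exists_pi_norm_eq_apply (β : Fin 3 → ℂ) : ∃ k, ‖β‖ = ‖β k‖ := by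
  obtain ⟨k, hk⟩ := Finite.exists_max fun k => ‖β k‖
  exact ⟨k, le_antisymm ((pi_norm_le_iff_of_nonneg (norm_nonneg _)).mpr hk) (norm_le_pi_norm β k)⟩

/-- **`max_{|ν| = D} |β^ν| = ‖β‖_∞^D`** — the same statement as `iSup_norm_veronese`
(`RoySmallValueGainVeronese.lean`, imported); kept as a deprecated alias (dedup-01076). [folklore] -/
@[deprecated (since := "2026-08-16")]
alias iSup_norm_prod_pow_eq := iSup_norm_veronese

/-! ### The gain -/

variable {ι : Type*} [Fintype ι] {L : IntermediateField ℚ ℂ} (Z : ZeroConfigK L ι) {D : ℕ}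

/-- The Veronese vector of a representative is non-zero. [folklore] -/
theorem veronese_rep_ne_zero (j : ι) :
    (fun ν : CoefIdx D => ∏ k, Z.rep j k ^ (ν.1 k)) ≠ 0 := by
  intro h
  let ν₀ : CoefIdx D := ⟨Finsupp.single (Z.piv j) D, by
    rw [mem_finsuppAntidiag]; exact ⟨by simp, subset_univ _⟩⟩
  have h1 := congr_fun h ν₀
  have h2 : (∏ k, Z.rep j k ^ (ν₀.1 k)) = 1 := by
    rw [Finset.prod_eq_single (Z.piv j) (fun k _ hk => by
      change Z.rep j k ^ (Finsupp.single (Z.piv j) D k) = 1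
      rw [Finsupp.single_apply, if_neg (Ne.symm hk), pow_zero]) (fun h => absurd (mem_univ _) h)]
    change Z.rep j (Z.piv j) ^ (Finsupp.single (Z.piv j) D (Z.piv j)) = 1
    rw [Finsupp.single_eq_same, show Z.rep j (Z.piv j) = 1 from Subtype.ext (Z.piv_one j), one_pow]
  rw [h2] at h1
  exact one_ne_zero h1

/-- The representatives have sup norm `≥ 1`. [folklore] -/
theorem one_le_norm_α (j : ι) : 1 ≤ ‖Z.α j‖ := by
  have h := norm_le_pi_norm (Z.α j) (Z.piv j)
  rwa [Z.piv_one, norm_one] at h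

variable [Normal ℚ L] [NumberField L]

/-- **The height gain** (Roy's `log|a| ≥ D h(Z) − O(D deg Z)`, exact for `Φ`): for the complex
factorisation `F₀ = c ∏_j ℓ_{α_j}^{e_j}` (exact multiplicities) of an integer polynomial `F₀ ≠ 0`
on the coefficient space of `ℂ[X]_D`,
`D ∑_j e_j h_K(a_j) ≤ [K:ℚ] (log|c| + D ∑_j e_j log ‖α_j‖_∞)`.
[cite: Roy2013, Proposition 2.3 and Proposition 6.2 (the height gain in `h_𝒞(Z) ≤ −C''(… + D h(Z))`)] -/
theorem gain {F₀ : MvPolynomial (CoefIdx D) ℤ} (hF₀ : F₀ ≠ 0) {c : ℂ} {e : ι → ℕ}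
    (hfac : map (Int.castRingHom ℂ) F₀ = C c * ∏ i, evalForm D (Z.α i) ^ e i)
    (hemax : ∀ i k, evalForm D (Z.α i) ^ k ∣ map (Int.castRingHom ℂ) F₀ → k ≤ e i) :
    (D : ℝ) * ∑ j, (e j : ℝ) * logHeight (Z.rep j) ≤
      Module.finrank ℚ L * (Real.log ‖c‖ + D * ∑ j, (e j : ℝ) * Real.log ‖Z.α j‖) := by
  classical
  obtain ⟨A, hAc, hK⟩ := exists_factorisation_fld Z hfac
  -- the shape consumed by the general inequality
  set cv : ι → CoefIdx D → L := fun j ν => ∏ k, Z.rep j k ^ (ν.1 k) with hcv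
  have hK' : map (Int.castRingHom L) F₀ = C A * ∏ j, (∑ ν, C (cv j ν) * X ν) ^ e j := by
    rw [hK]; rfl
  have hcv0 : ∀ j, cv j ≠ 0 := fun j => veronese_rep_ne_zero Z j
  haveI : Nonempty (CoefIdx D) := ⟨⟨Finsupp.single 0 D, by
    rw [mem_finsuppAntidiag]; exact ⟨by simp, subset_univ _⟩⟩⟩
  have h := sum_mul_logHeight_le_sum_embeddings' hF₀ hcv0 hK'
  -- left-hand side: Veronese
  have hL : ∑ j, (e j : ℝ) * logHeight (cv j) = (D : ℝ) * ∑ j, (e j : ℝ) * logHeight (Z.rep j) := by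
    rw [Finset.mul_sum]
    refine Finset.sum_congr rfl fun j _ => ?_
    rw [hcv, logHeight_veronese (Z.rep j) (Z.rep_ne_zero j)]
    ring
  -- right-hand side: every summand is the same
  have hc0 : c ≠ 0 := by
    rintro rfl
    rw [C_0, zero_mul] at hfac
    exact hF₀ (map_injective _ Int.cast_injective (by rw [hfac, map_zero]))
  have hR : ∀ σ : L →+* ℂ, ‖σ A‖ * ∏ j, (⨆ ν, ‖σ (cv j ν)‖) ^ e j =
      ‖c‖ * ∏ j, (‖Z.α j‖ ^ D) ^ e j := by
    intro σ
    set g := ZeroConfigK.autOfEmb σ with hg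
    have h1 : σ A = c := by rw [← ZeroConfigK.coe_autOfEmb σ A]; exact coe_algEquiv_leading_eq Z hfac hemax hK g
    have h2 : ∀ j, (⨆ ν, ‖σ (cv j ν)‖) = ‖Z.α (Z.perm g j)‖ ^ D := fun j => by
      have h3 : ∀ ν : CoefIdx D, σ (cv j ν) = ∏ k, Z.α (Z.perm g j) k ^ (ν.1 k) := fun ν => by
        rw [hcv]
        simp only [map_prod, map_pow]
        refine Finset.prod_congr rfl fun k _ => ?_
        rw [← ZeroConfigK.coe_autOfEmb σ]
        exact congrArg (· ^ (ν.1 k)) (congr_fun (Z.img_eq g j) k)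
      simp_rw [h3]
      exact iSup_norm_veronese _
    simp_rw [h1, h2]
    rw [prod_perm_pow_eq Z hfac hemax g (fun j => ‖Z.α j‖ ^ D)]
  simp_rw [hR] at h
  rw [Finset.sum_const, Finset.card_univ, Embeddings.card, nsmul_eq_mul] at h
  -- evaluate the logarithm
  have hpos : ∀ j, 0 < ‖Z.α j‖ := fun j => lt_of_lt_of_le one_pos (one_le_norm_α Z j)
  have hlog : Real.log (‖c‖ * ∏ j, (‖Z.α j‖ ^ D) ^ e j) =
      Real.log ‖c‖ + D * ∑ j, (e j : ℝ) * Real.log ‖Z.α j‖ := by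
    rw [Real.log_mul (norm_ne_zero_iff.mpr hc0)
      (Finset.prod_ne_zero_iff.mpr fun j _ => pow_ne_zero _ (pow_ne_zero _ (hpos j).ne')),
      Real.log_prod (fun j _ => pow_ne_zero _ (pow_ne_zero _ (hpos j).ne')), Finset.mul_sum]
    congr 1
    refine Finset.sum_congr rfl fun j _ => ?_
    rw [Real.log_pow, Real.log_pow]; ring
  rw [hL] at h
  rw [← hlog]
  exact h

end Roy2013

end Literature.NumberTheory.Transcendental
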